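import Mathlib.Combinatorics.Colex
import Literature.Computability.Complexity.LundYannakakis
import HarnessLib

/-!
# The Lund–Yannakakis reduction, II: the complementary pair and the averaging step

Topic `Computability/Complexity`, namespace `Literature.Computability.Complexity` (dot-lemmas
under `LabelCoverInstance`). Continues `LundYannakakis.lean` (construction `lyReduce`, patched
map `lyMap`, completeness `lyReduce_mem_yesSet`) with the two combinatorial ingredients of the
NO case of Arora–Barak 2009, Thm. 22.31 for the hypercube set gadget `B = {0,1}^W`,
`C_u = {b | b_u = 1}`; file III (`LundYannakakisSoundness.lean`) finishes the counting.

Let `T` cover `lyReduce φ`, `φ` well formed and regular of degree `d` (`n d = 2m`,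
`WellFormed.exists_degree`). For a variable `i` let `A_i = {u < W | S_{i,u} ∈ T}` ("the values
associated with `i`"; in Lean the `Finset` `(range W).filter fun u => W * i + u ∈ T`, the index
of `S_{i,u}` being `W i + u`), `a_i = |A_i|`, so `|T| = Σ_{i<n} a_i` (`card_eq_sum_card_assoc`).
* Complementary pair (`exists_good_pair`, the hypercube instance of Def. 22.32, valid with no
  bound on the number of sets): every constraint `r = (i, j, h)` has `u ∈ A_i`, `v ∈ A_j` with
  `h u = v` — otherwise the point `b ∈ {0,1}^W` with `b_v = 1 ⇔ v ∈ h(A_i)` of the block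
  `{r} × B` lies in no chosen set. Hence every `A_i`, `i < n`, is nonempty (`assoc_nonempty`).
* Averaging (`exists_assignment`; the printed random assignment "picking for each variable one
  of the values associated with it", by linearity of expectation): over the box `Π_{i<n} A_i` of
  choice functions constraint `r` holds on the sub-box `{g | g i_r = u, g j_r = v}`, a fraction
  `1/(a_{i_r} a_{j_r})` (`card_piFinset_le`), so some assignment satisfies at least
  `Σ_r 1/(a_{i_r} a_{j_r})` constraints.

## References

* S. Arora, B. Barak, *Computational Complexity: A Modern Approach*, CUP 2009, §22.8:
  Thm. 22.31, Def. 22.32 and the proof ("The analysis", Claim), pp. 486–488.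
* C. Lund, M. Yannakakis, *On the hardness of approximating minimization problems*, J. ACM 41
  (1994) 960–981, §3.
-/

namespace Literature.Computability.Complexity

open _root_.Computability Finset

/-! ### Two elementary summation facts -/

/-- Swapping a finite sum with a sum over a list. [folklore] -/
theorem finsetSum_listSum_map {ι α M : Type*} [AddCommMonoid M] (s : Finset ι) (L : List α)
    (F : ι → α → M) :
    ∑ g ∈ s, (L.map (F g)).sum = (L.map fun x => ∑ g ∈ s, F g x).sum := by
  induction L with
  | nil => simp
  | cons x L ih => simp only [List.map_cons, List.sum_cons, Finset.sum_add_distrib, ih]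

/-- `countP` as a sum of indicators (real-valued). [folklore] -/
theorem cast_countP_eq_sum_map {α : Type*} (p : α → Bool) (L : List α) :
    (L.countP p : ℝ) = (L.map fun x => if p x = true then (1 : ℝ) else 0).sum := by
  induction L with
  | nil => simp
  | cons x L ih =>
    rw [List.countP_cons, List.map_cons, List.sum_cons, Nat.cast_add, ih, add_comm]
    congr 1
    split_ifs <;> simp

namespace LabelCoverInstance

/-! ### Degrees and regularity -/

/-- Reindexing a sum over constraints by one of its variables:
`Σ_C g (π C) = Σ_{i<n} #{C | π C = i} • g i` when all `π C < n`. [folklore] -/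
theorem sum_map_comp_eq_sum_countP_smul {M : Type*} [AddCommMonoid M]
    (L : List LabelCoverConstraint) (π : LabelCoverConstraint → ℕ) {n : ℕ}
    (hL : ∀ C ∈ L, π C < n) (g : ℕ → M) :
    (L.map fun C => g (π C)).sum = ∑ i ∈ range n, (L.countP fun C => π C = i) • g i := by
  induction L with
  | nil => simp
  | cons C L ih =>
    have hC : π C < n := hL C (by simp)
    rw [List.map_cons, List.sum_cons, ih fun C' h => hL C' (by simp [h])]
    simp only [List.countP_cons, add_smul, Finset.sum_add_distrib, decide_eq_true_eq, ite_smul,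
      one_smul, zero_smul]
    rw [add_comm, Finset.sum_ite_eq, if_pos (Finset.mem_range.2 hC)]

/-- **Degree-weighted sums**: `Σ_r (g i_r + g j_r) = Σ_{i<n} degree(i) • g i` on a well-formed
instance. [cite: AroraBarak2009, §22.3 (regular instances, p. 470)] -/
theorem WellFormed.sum_map_add_eq_sum_degree_smul {M : Type*} [AddCommMonoid M]
    {φ : LabelCoverInstance} (hwf : φ.WellFormed) (g : ℕ → M) :
    (φ.constraints.map fun C => g C.fst + g C.snd).sum =
      ∑ i ∈ range φ.numVars, φ.degree i • g i := by
  rw [List.sum_map_add,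
    sum_map_comp_eq_sum_countP_smul _ (fun C => C.fst) (fun C hC => (hwf.2 C hC).1) g,
    sum_map_comp_eq_sum_countP_smul _ (fun C => C.snd) (fun C hC => (hwf.2 C hC).2.1) g,
    ← Finset.sum_add_distrib]
  refine Finset.sum_congr rfl fun i _ => ?_
  rw [degree, add_smul]

/-- The degrees of a well-formed instance sum to `2m`.
[cite: AroraBarak2009, §22.3 (regular instances, p. 470)] -/
theorem WellFormed.sum_degree {φ : LabelCoverInstance} (hwf : φ.WellFormed) :
    ∑ i ∈ range φ.numVars, φ.degree i = 2 * φ.numConstraints := by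
  have h := hwf.sum_map_add_eq_sum_degree_smul (M := ℕ) fun _ => 1
  simp only [smul_eq_mul, mul_one, List.map_const', List.sum_replicate] at h
  rw [← h, numConstraints]
  ring

/-- **A well-formed regular instance has a positive common degree `d` with `n d = 2m`.**
[cite: AroraBarak2009, §22.3 (regular instances, p. 470)] -/
theorem WellFormed.exists_degree {φ : LabelCoverInstance} (hwf : φ.WellFormed)
    (hreg : φ.IsRegular) :
    ∃ d : ℕ, 0 < d ∧ (∀ i < φ.numVars, φ.degree i = d) ∧
      φ.numVars * d = 2 * φ.numConstraints := by
  obtain ⟨d, hd⟩ := hreg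
  have hsum : φ.numVars * d = 2 * φ.numConstraints := by
    rw [← hwf.sum_degree, Finset.sum_congr rfl fun i hi => hd i (Finset.mem_range.1 hi),
      Finset.sum_const, Finset.card_range, smul_eq_mul]
  refine ⟨d, Nat.pos_of_ne_zero fun h0 => ?_, hd, hsum⟩
  rw [h0, Nat.mul_zero] at hsum
  have := hwf.1
  omega

/-- Regular well-formed instances have `n ≤ 2m` (every variable occurs).
[cite: AroraBarak2009, §22.3 (regular instances, p. 470)] -/
theorem numVars_le_two_mul_numConstraints {φ : LabelCoverInstance} (hwf : φ.WellFormed)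
    (hreg : φ.IsRegular) : φ.numVars ≤ 2 * φ.numConstraints := by
  obtain ⟨d, hd, -, hnd⟩ := hwf.exists_degree hreg
  calc φ.numVars ≤ φ.numVars * d := Nat.le_mul_of_pos_right _ hd
    _ = 2 * φ.numConstraints := hnd

/-- On the promise (alphabet `[W]`, well formed, regular) the patched map is the construction.
[cite: AroraBarak2009, proof of Thm. 22.31 (§22.8)] -/
theorem lyMap_eq_lyReduce {φ : LabelCoverInstance} {W : ℕ} (hW : φ.alphabetSize = W)
    (hwf : φ.WellFormed) (hreg : φ.IsRegular) : lyMap W φ = φ.lyReduce := by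
  unfold lyMap
  rw [if_pos ⟨hW, numVars_le_two_mul_numConstraints hwf hreg⟩]

/-! ### Associated values of a cover and the complementary pair -/

/-- **`|T| = Σ_{i<n} a_i`** for a family of indices `< n W`, `a_i = |A_i|` the number of values
associated with `i` ("the average number of values associated per variable is `|T|/n`").
[cite: AroraBarak2009, proof of Thm. 22.31 (§22.8)] -/
theorem card_eq_sum_card_assoc (φ : LabelCoverInstance) {T : Finset ℕ}
    (hT : ∀ p ∈ T, p < φ.numVars * φ.alphabetSize) :
    T.card = ∑ i ∈ range φ.numVars,
      ((range φ.alphabetSize).filter fun u => φ.alphabetSize * i + u ∈ T).card := by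
  set W := φ.alphabetSize
  have hWpos : ∀ p ∈ T, 0 < W := fun p hp =>
    Nat.pos_of_ne_zero fun h0 => by have := hT p hp; rw [h0, Nat.mul_zero] at this; omega
  rw [Finset.card_eq_sum_card_fiberwise (f := fun p => p / W) (t := range φ.numVars)
    (fun p hp => Finset.mem_range.2 ((Nat.div_lt_iff_lt_mul (hWpos p hp)).2 (hT p hp)))]
  refine Finset.sum_congr rfl fun i _ => ?_
  rw [← Finset.card_image_of_injective ((range W).filter fun u => W * i + u ∈ T)
    (add_right_injective (W * i))]
  congr 1
  ext p
  simp only [Finset.mem_filter, Finset.mem_image, Finset.mem_range]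
  constructor
  · rintro ⟨hp, rfl⟩
    have hW := hWpos p hp
    exact ⟨p % W, ⟨Nat.mod_lt _ hW, by rw [Nat.div_add_mod]; exact hp⟩, Nat.div_add_mod p W⟩
  · rintro ⟨u, ⟨hu, huT⟩, rfl⟩
    have hW : 0 < W := hWpos _ huT
    exact ⟨huT, by rw [Nat.mul_add_div hW, Nat.div_eq_of_lt hu, add_zero]⟩

/-- **The complementary pair (hypercube instance of the `(k, W)`-set gadget, Def. 22.32).** If
`T` covers `lyReduce φ` then every constraint `(i, j, h)` has associated values `u ∈ A_i`,
`v ∈ A_j` with `h u = v`: otherwise the point `b` of the block of this constraint with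
`b_v = 1 ⇔ v ∈ h(A_i)` lies in no `C_v`, `v ∈ A_j`, and in no `B ∖ C_{h u}`, `u ∈ A_i`
("any cover of `B` … must contain two sets that are complements of one another. We conclude
that there are values `u, v` associated with `i, j`, respectively such that `h(u) = v`").
[cite: AroraBarak2009, proof of Thm. 22.31 (§22.8, Claim)] -/
theorem exists_good_pair {φ : LabelCoverInstance} (hwf : φ.WellFormed) {T : Finset ℕ}
    (hT : φ.lyReduce.IsCover T) {C : LabelCoverConstraint} (hC : C ∈ φ.constraints) :
    ∃ u ∈ (range φ.alphabetSize).filter fun u => φ.alphabetSize * C.fst + u ∈ T,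
      ∃ v ∈ (range φ.alphabetSize).filter fun u => φ.alphabetSize * C.snd + u ∈ T,
        u < C.proj.length ∧ C.projAt u = v := by
  classical
  obtain ⟨r, hr, hCr⟩ := List.getElem_of_mem hC
  set W := φ.alphabetSize with hWdef
  have hwC : C.WellFormed φ.numVars W := hwf.2 C hC
  by_contra H
  push Not at H
  set s : Finset ℕ := ((range W).filter fun u => W * C.fst + u ∈ T).image C.projAt with hs
  have hsW : ∀ v ∈ s, v < W := by
    intro v hv
    obtain ⟨u, hu, rfl⟩ := Finset.mem_image.1 hv
    exact hwC.projAt_lt (Finset.mem_range.1 (Finset.mem_filter.1 hu).1)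
  -- the uncovered point of the block of constraint `r`
  set b : ℕ := ∑ v ∈ s, 2 ^ v with hb
  have hbW : b < 2 ^ W := Nat.geomSum_lt le_rfl hsW
  have htest : ∀ v, b.testBit v = true ↔ v ∈ s := fun v => by
    rw [hb, ← Nat.mem_bitIndices, ← List.mem_toFinset, Finset.toFinset_bitIndices_sum_two_pow]
  have he : 2 ^ W * r + b < φ.lyReduce.univSize := by
    rw [lyReduce_univSize]
    calc 2 ^ W * r + b < 2 ^ W * r + 2 ^ W := by omega
      _ = 2 ^ W * (r + 1) := by ring
      _ ≤ 2 ^ W * φ.numConstraints := Nat.mul_le_mul_left _ hr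
      _ = φ.numConstraints * 2 ^ W := Nat.mul_comm _ _
  obtain ⟨p, hpT, hpe⟩ := hT.2 _ he
  have hp : p < φ.numVars * W := by
    have := hT.1 p hpT
    rwa [length_lyReduce_sets] at this
  have hWpos : 0 < W := Nat.pos_of_ne_zero fun h0 => by
    rw [h0, Nat.mul_zero] at hp
    exact Nat.not_lt_zero _ hp
  rw [φ.mem_subsetAt_lyReduce hp, φ.lyMem_block hr hbW, hCr,
    LabelCoverConstraint.lyRow_eq_true_iff] at hpe
  obtain ⟨-, hrow⟩ := hpe
  have hpu : p % W < W := Nat.mod_lt _ hWpos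
  have hp_eq : W * (p / W) + p % W = p := Nat.div_add_mod p W
  rcases hrow with ⟨hsnd, htb⟩ | ⟨hfst, htb⟩
  · obtain ⟨u, hu, hproj⟩ := Finset.mem_image.1 ((htest _).1 htb)
    have hv : p % W ∈ (range W).filter fun u => W * C.snd + u ∈ T :=
      Finset.mem_filter.2 ⟨Finset.mem_range.2 hpu, by rw [hsnd, hp_eq]; exact hpT⟩
    have hulen : u < C.proj.length := by
      rw [hwC.2.2.2.1]
      exact Finset.mem_range.1 (Finset.mem_filter.1 hu).1
    exact H u hu _ hv hulen hproj
  · have hu : p % W ∈ (range W).filter fun u => W * C.fst + u ∈ T :=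
      Finset.mem_filter.2 ⟨Finset.mem_range.2 hpu, by rw [hfst, hp_eq]; exact hpT⟩
    have hmem : C.projAt (p % W) ∈ s := Finset.mem_image_of_mem _ hu
    rw [(htest _).2 hmem] at htb
    exact Bool.noConfusion htb

/-- Every associated-value set `A_i` of a variable `i < n` is nonempty when `T` covers
`lyReduce φ` (`φ` well formed and regular: `i` occurs in some constraint, which has a
complementary pair). [cite: AroraBarak2009, proof of Thm. 22.31 (§22.8, Claim)] -/
theorem assoc_nonempty {φ : LabelCoverInstance} (hwf : φ.WellFormed) (hreg : φ.IsRegular)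
    {T : Finset ℕ} (hT : φ.lyReduce.IsCover T) {i : ℕ} (hi : i < φ.numVars) :
    ((range φ.alphabetSize).filter fun u => φ.alphabetSize * i + u ∈ T).Nonempty := by
  obtain ⟨d, hd, hdeg, -⟩ := hwf.exists_degree hreg
  have hdi : 0 < φ.degree i := (hdeg i hi).symm ▸ hd
  rw [degree, Nat.add_pos_iff_pos_or_pos, List.countP_pos_iff, List.countP_pos_iff] at hdi
  rcases hdi with ⟨C, hC, hCi⟩ | ⟨C, hC, hCi⟩
  · obtain ⟨u, hu, -⟩ := exists_good_pair hwf hT hC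
    exact ⟨u, (of_decide_eq_true hCi) ▸ hu⟩
  · obtain ⟨-, -, v, hv, -⟩ := exists_good_pair hwf hT hC
    exact ⟨v, (of_decide_eq_true hCi) ▸ hv⟩

/-! ### Averaging over the product of the associated value sets -/

/-- **Conditioning a product space on two coordinates**: for `f ≠ s`, `u ∈ A f`, `v ∈ A s`,
`|Π A| ≤ #{g ∈ Π A | g f = u, g s = v} · |A f| · |A s|` (the map
`g ↦ (g[f ↦ u][s ↦ v], g f, g s)` is injective). [folklore] -/
theorem card_piFinset_le {n : ℕ} (A : Fin n → Finset ℕ) {f s : Fin n} (hfs : f ≠ s)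
    {u v : ℕ} (hu : u ∈ A f) (hv : v ∈ A s) :
    (Fintype.piFinset A).card ≤
      ((Fintype.piFinset A).filter fun g => g f = u ∧ g s = v).card *
        ((A f).card * (A s).card) := by
  classical
  rw [← Finset.card_product, ← Finset.card_product]
  refine Finset.card_le_card_of_injOn
    (fun g => (Function.update (Function.update g f u) s v, (g f, g s))) ?_ ?_
  · intro g hg
    rw [Finset.mem_coe, Fintype.mem_piFinset] at hg
    simp only [Finset.mem_coe, Finset.mem_product, Finset.mem_filter, Fintype.mem_piFinset]
    refine ⟨⟨fun i => ?_, ?_, ?_⟩, hg f, hg s⟩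
    · rcases eq_or_ne i s with rfl | his
      · rw [Function.update_self]; exact hv
      · rw [Function.update_of_ne his]
        rcases eq_or_ne i f with rfl | hif
        · rw [Function.update_self]; exact hu
        · rw [Function.update_of_ne hif]; exact hg i
    · rw [Function.update_of_ne hfs, Function.update_self]
    · rw [Function.update_self]
  · intro g₁ _ g₂ _ h
    simp only [Prod.mk.injEq] at h
    obtain ⟨hupd, hf, hs'⟩ := h
    funext i
    rcases eq_or_ne i s with rfl | his
    · exact hs'
    rcases eq_or_ne i f with rfl | hif
    · exact hf
    have := congrFun hupd i
    rwa [Function.update_of_ne his, Function.update_of_ne hif, Function.update_of_ne his,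
      Function.update_of_ne hif] at this

/-- **The averaging step ("we pick a value for `i` by randomly picking one of the values
associated with it … linearity of expectation").** If `T` covers `lyReduce φ` (`φ` well formed,
regular) then some assignment satisfies at least `Σ_r 1/(a_{i_r} · a_{j_r})` constraints,
`a_i = |A_i|`: averaged over the box `Π_{i<n} A_i`, constraint `r` holds with frequency
`≥ 1/(a_{i_r} a_{j_r})` by the complementary pair.
[cite: AroraBarak2009, proof of Thm. 22.31 (§22.8, Claim)] -/
theorem exists_assignment {φ : LabelCoverInstance} (hwf : φ.WellFormed) (hreg : φ.IsRegular)
    {T : Finset ℕ} (hT : φ.lyReduce.IsCover T) :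
    ∃ a : ℕ → ℕ, (φ.constraints.map fun C =>
      ((((range φ.alphabetSize).filter fun u => φ.alphabetSize * C.fst + u ∈ T).card : ℝ) *
        ((range φ.alphabetSize).filter fun u => φ.alphabetSize * C.snd + u ∈ T).card)⁻¹).sum
      ≤ φ.satCount a := by
  classical
  set n := φ.numVars with hn
  set W := φ.alphabetSize with hW
  -- the assignment of a choice function `g` on `Fin n` (junk `0` on variables `≥ n`, never read)
  let toA : (Fin n → ℕ) → ℕ → ℕ := fun g i => if h : i < n then g ⟨i, h⟩ else 0
  have toA_of_lt : ∀ (g : Fin n → ℕ) {i : ℕ} (hi : i < n), toA g i = g ⟨i, hi⟩ :=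
    fun g i hi => dif_pos hi
  set A : Fin n → Finset ℕ := fun i => (range W).filter fun u => W * (i : ℕ) + u ∈ T with hA
  set Ω := Fintype.piFinset A with hΩ
  have hΩne : Ω.Nonempty :=
    Fintype.piFinset_nonempty.2 fun i => assoc_nonempty hwf hreg hT i.2
  set G : LabelCoverConstraint → ℝ := fun C =>
    ((((range W).filter fun u => W * C.fst + u ∈ T).card : ℝ) *
      ((range W).filter fun u => W * C.snd + u ∈ T).card)⁻¹ with hG
  -- per constraint: the conditioned sub-box satisfies it
  have hper : ∀ C ∈ φ.constraints,
      (Ω.card : ℝ) * G C ≤ ∑ g ∈ Ω, (if C.Sat (toA g) = true then (1 : ℝ) else 0) := by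
    intro C hC
    have hwC := hwf.2 C hC
    obtain ⟨u, hu, v, hv, hulen, hproj⟩ := exists_good_pair hwf hT hC
    set f : Fin n := ⟨C.fst, hwC.1⟩ with hf
    set s : Fin n := ⟨C.snd, hwC.2.1⟩ with hs
    have hfs : f ≠ s := fun h => hwC.2.2.1 (by simpa [hf, hs] using congrArg Fin.val h)
    have hcard := card_piFinset_le A hfs (u := u) (v := v) hu hv
    have hsub : (Ω.filter fun g => g f = u ∧ g s = v) ⊆
        Ω.filter fun g => C.Sat (toA g) = true := by
      intro g hg
      rw [Finset.mem_filter] at hg ⊢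
      refine ⟨hg.1, LabelCoverConstraint.sat_of_projAt_eq ?_ ?_⟩
      · rw [toA_of_lt g hwC.1]
        change g f < C.proj.length
        rw [hg.2.1]; exact hulen
      · rw [toA_of_lt g hwC.1, toA_of_lt g hwC.2.1]
        change C.projAt (g f) = g s
        rw [hg.2.1, hg.2.2]; exact hproj
    rw [Finset.sum_boole]
    have hapos : (0 : ℝ) < (A f).card := by exact_mod_cast Finset.card_pos.2 ⟨u, hu⟩
    have hbpos : (0 : ℝ) < (A s).card := by exact_mod_cast Finset.card_pos.2 ⟨v, hv⟩
    have h1 : (Ω.card : ℝ) ≤ ((Ω.filter fun g => g f = u ∧ g s = v).card : ℝ) *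
        ((A f).card * (A s).card) := by exact_mod_cast hcard
    have h2 : ((Ω.filter fun g => g f = u ∧ g s = v).card : ℝ) ≤
        (Ω.filter fun g => C.Sat (toA g) = true).card := by
      exact_mod_cast Finset.card_le_card hsub
    rw [hG]
    change (Ω.card : ℝ) * (((A f).card : ℝ) * (A s).card)⁻¹ ≤ _
    rw [← div_eq_mul_inv, div_le_iff₀ (mul_pos hapos hbpos)]
    exact h1.trans (mul_le_mul_of_nonneg_right h2 (by positivity))
  -- sum over the constraints and swap the sums
  have hsum : (Ω.card : ℝ) * (φ.constraints.map G).sum ≤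
      ∑ g ∈ Ω, (φ.satCount (toA g) : ℝ) := by
    have : ∑ g ∈ Ω, (φ.satCount (toA g) : ℝ) =
        (φ.constraints.map fun C => ∑ g ∈ Ω,
          (if C.Sat (toA g) = true then (1 : ℝ) else 0)).sum := by
      rw [← finsetSum_listSum_map]
      exact Finset.sum_congr rfl fun g _ => cast_countP_eq_sum_map _ _
    rw [this, ← List.sum_map_mul_left]
    exact List.sum_le_sum hper
  -- some point of the box is at least average
  have hconst : ∑ _g ∈ Ω, (φ.constraints.map G).sum =
      (Ω.card : ℝ) * (φ.constraints.map G).sum := by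
    rw [Finset.sum_const, nsmul_eq_mul]
  obtain ⟨g, -, hg⟩ := Finset.exists_le_of_sum_le hΩne (hconst ▸ hsum)
  exact ⟨toA g, hg⟩

end LabelCoverInstance

end Literature.Computability.Complexity
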